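import Mathlib
import Summits.KontsevichZagierPeriods.Zeta5Search.CatalanTwoAdicTheta
import Summits.KontsevichZagierPeriods.Zeta5Search.CatalanTwoAdicFinal
import HarnessLib

/-!
# Catalan box family — kernel K5d: `ξ = ζ₂(2)` for the explicit Kubota–Leopoldt series (second link of (C6))

HONEST FRAMING: systematic search; no irrationality claim unless certified.

Cell `pub-zeta5`, seat `fam-catalan` (generation 5), successor project "kernel K5d" (`families/catalan/FAMILY.md` §11).
Kernel K5b (`CatalanTwoAdicTheta.hasSum_genocchi`, generation 4) proved `8·ξ = Σ_{k≥0} G_k(−2)^{k+1} = −Θ₂(½)` in `ℚ₂`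
for the lane's constant `ξ = ⅛ Σ'_μ t_μ/(μ+½)` (`CatalanTwoAdicXi.xi`).  The remaining, printed, link of the paper's
(C6) is Beukers' `Θ₂(½) = −8ζ₂(2)` ([Be08, Prop. 9], Kubota–Leopoldt `ζ₂`).  This file makes that link kernel-checked
RELATIVE TO AN EXPLICIT DEFINITION of the value `ζ₂(2)`:

* `zetaTwoAtTwo := H₂(2;1,4) + H₂(2;3,4)` with `H₂(2;a,F) := (1/F)·(ω(a)/a)·Σ'_{j≥0} binom(−1,j)·B_j·(F/a)^j`
  (`hurwitzTwoAtTwo`; `ω(a) = (−1)^{(a−1)/2}` Beukers' Teichmüller character at `2`, `B_j` = Mathlib's `bernoulli`,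
  `B₁ = −½`).  This is, symbol for symbol, the `s = 2`, `p = 2`, `χ = 1`, `F = 4` instance of the Bernoulli-series
  formula by which the Kubota–Leopoldt function is given in [Wa97, Thm. 5.11] and [Be08, Appendix]
  (`L_p(s,χ) = (1/F)(1/(s−1)) Σ_a χ(a)⟨a⟩^{1−s} Σ_j binom(1−s,j) B_j (F/a)^j`, `ζ₂(s) = H₂(s,1,4) + H₂(s,3,4)`).
  That this series IS the analytic Kubota–Leopoldt zeta function (interpolation of `ζ(1−n)`) is Washington's theorem and
  stays PRINTED; Lean has no Kubota–Leopoldt `ζ_p` to compare with.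
* **`xi_eq_zetaTwoAtTwo : xi = zetaTwoAtTwo`** (0 sorry).  Proof: `H₂(2;1,4) = ¼Σ_n B_n(−4)^n` termwise;
  `H₂(2;3,4) = −(1/12)Σ_j B_j(−4/3)^j`, and the second series is RE-EXPANDED 2-adically — `(−4/3)^j = 3(−4)^j/3^{j+1}`,
  `1/3^{j+1} = Σ_m binom(m+j,j)(−2)^m` (`‖−2‖₂ < 1`) — into the absolutely summable double family
  `E(j,m) = B_j(−4)^j binom(m+j,j)(−2)^m`, whose antidiagonal sums are `(−2)^n Σ_k binom(n,k)2^k B_k = (2−2^n)B_n(−2)^n`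
  by the coefficient identity `Σ_k binom(n,k)2^kB_k = (2−2^n)B_n` ([Be08, Prop. 7(iii)] `R(x)+R(x+½) = 4R(2x)` in
  coefficient form; here from the Genocchi recurrence of `CatalanTwoAdicGenocchi` and Mathlib's `sum_bernoulli`).  Hence
  `ζ₂(2) = ¼Σ_n (B_n(−4)^n − (2−2^n)B_n(−2)^n) = ¼Σ_n (2^{n+1}−2)B_n(−2)^n = ⅛Σ_k G_k(−2)^{k+1} = ξ` by K5b.
  The only 2-adic size information used is the crude bound `‖B_n‖₂ ≤ C·2^n`, itself read off K5b's `summable_genocchi`.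
* Corollaries: Beukers' forms `ζ₂(2) = (R₂(¾) − R₂(¼))/16`, `Θ₂(½) = (R₂(¼) − R₂(¾))/2 = −8ζ₂(2)` ([Be08, §5]; the
  display "`= 8ζ₂(2)`" on [Be08, p. 8] is a misprint for the `−8ζ₂(2)` of Prop. 9, as the kernel confirms), and
  `zetaTwoAtTwo_not_ratCast : ζ₂(2) ∉ ℚ` for this explicitly defined number, from the lane's `xi_not_ratCast`
  (`CatalanTwoAdicFinal`) — an irrationality statement that IS certified (kernel-checked), for the number defined here;
  in print: Calegari 2005, [Be08, Cor. 14] (for the analytic `ζ₂(2)`).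
-/

open Finset Nat

noncomputable section

namespace Summit.KontsevichZagierPeriods.Zeta5Search.CatalanTwoAdicZeta

open CatalanTwoAdicSeries (xi norm_two_padic xi_not_ratCast)
open CatalanTwoAdicGenocchi (genocchi genocchi_recurrence)
open CatalanTwoAdicTheta (hasSum_genocchi summable_genocchi)

/-! ### The coefficient identity `Σ_k binom(n,k)·2^k·B_k = (2 − 2^n)·B_n` -/

/-- `Σ_{k=0}^{n} binom(n,k)·B_k = B_n + [n = 1]` (Mathlib's `sum_bernoulli` = [Be08, Lemma 6], plus the `k = n` term). -/
theorem sum_range_succ_choose_mul_bernoulli (n : ℕ) :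
    ∑ k ∈ range (n + 1), (n.choose k : ℚ) * bernoulli k = bernoulli n + if n = 1 then 1 else 0 := by
  rw [sum_range_succ, sum_bernoulli, choose_self, cast_one, one_mul]
  exact add_comm _ _

/-- **[Be08, Prop. 7(iii)] in coefficient form:** `Σ_{k=0}^{n} binom(n,k)·2^k·B_k = (2 − 2^n)·B_n`.
(From the Genocchi recurrence `Σ_k binom(n,k)G_k + G_n = 2[n=1]` with `G_k = 2B_k − 2·2^kB_k`, and the previous lemma.) -/
theorem sum_choose_mul_two_pow_mul_bernoulli (n : ℕ) :
    ∑ k ∈ range (n + 1), (n.choose k : ℚ) * 2 ^ k * bernoulli k = (2 - 2 ^ n) * bernoulli n := by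
  have h1 := genocchi_recurrence n
  have hsum : ∑ k ∈ range (n + 1), (n.choose k : ℚ) * genocchi k =
      2 * ∑ k ∈ range (n + 1), (n.choose k : ℚ) * bernoulli k
        - 2 * ∑ k ∈ range (n + 1), (n.choose k : ℚ) * 2 ^ k * bernoulli k := by
    rw [mul_sum, mul_sum, ← sum_sub_distrib]
    refine sum_congr rfl fun k _ => ?_
    rw [genocchi, pow_succ]
    ring
  rw [hsum, sum_range_succ_choose_mul_bernoulli, genocchi, pow_succ] at h1
  split_ifs at h1 <;> linear_combination (-1 / 2 : ℚ) * h1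

/-! ### `B_n` in `ℚ₂` and a crude 2-adic growth bound read off K5b -/

/-- The Bernoulli number `B_n` (Mathlib's `bernoulli`, `B₁ = −½`) as an element of `ℚ₂`. -/
def bernTwo (n : ℕ) : ℚ_[2] := ((bernoulli n : ℚ) : ℚ_[2])

/-- `‖1 − 2^k‖₂ = 1` for `k ≥ 1` (all 2-adic triangles are isosceles). -/
theorem norm_one_sub_two_pow {k : ℕ} (hk : k ≠ 0) : ‖(1 : ℚ_[2]) - 2 ^ k‖ = 1 := by
  have h2 : ‖-((2 : ℚ_[2]) ^ k)‖ = ((1 : ℝ) / 2) ^ k := by rw [norm_neg, norm_pow, norm_two_padic]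
  have hlt : ((1 : ℝ) / 2) ^ k < 1 := pow_lt_one₀ (by norm_num) (by norm_num) hk
  have hne : ‖(1 : ℚ_[2])‖ ≠ ‖-((2 : ℚ_[2]) ^ k)‖ := by rw [norm_one, h2]; exact hlt.ne'
  rw [sub_eq_add_neg, IsUltrametricDist.norm_add_eq_max_of_norm_ne_norm hne, norm_one, h2, max_eq_left hlt.le]

/-- For `k ≥ 1`: `‖G_k·(−2)^{k+1}‖₂ = ‖B_k‖₂·2^{−(k+2)}` (`G_k = 2(1 − 2^k)B_k` with `1 − 2^k` a 2-adic unit). -/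
theorem norm_genocchi_term {k : ℕ} (hk : k ≠ 0) :
    ‖((genocchi k * (-2) ^ (k + 1) : ℚ) : ℚ_[2])‖ = ‖bernTwo k‖ * ((1 : ℝ) / 2) ^ (k + 2) := by
  have e : ((genocchi k * (-2) ^ (k + 1) : ℚ) : ℚ_[2]) = 2 * ((1 : ℚ_[2]) - 2 ^ k) * bernTwo k * (-2) ^ (k + 1) := by
    rw [genocchi, bernTwo]; push_cast; ring
  rw [e, norm_mul, norm_mul, norm_mul, norm_one_sub_two_pow hk, norm_pow, norm_neg, norm_two_padic]
  ring

/-- **Crude 2-adic growth of the Bernoulli numbers:** `∃ C > 0, ∀ n, ‖B_n‖₂ ≤ C·2^n`.  Read off K5b's by-product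
`summable_genocchi`: the terms `G_k(−2)^{k+1}` tend to `0`, so `‖B_k‖₂·2^{−(k+2)} < 1` eventually.  (Von Staudt–Clausen
would give `‖B_n‖₂ ≤ 2`; it is neither available nor needed.) -/
theorem exists_norm_bernTwo_le : ∃ C : ℝ, 0 < C ∧ ∀ n, ‖bernTwo n‖ ≤ C * 2 ^ n := by
  have ht := summable_genocchi.tendsto_atTop_zero
  rw [NormedAddGroup.tendsto_nhds_zero] at ht
  obtain ⟨N, hN⟩ := Filter.eventually_atTop.mp (ht 1 one_pos)
  have hS0 : 0 ≤ ∑ i ∈ range (N + 1), ‖bernTwo i‖ := sum_nonneg fun i _ => norm_nonneg _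
  refine ⟨4 + ∑ i ∈ range (N + 1), ‖bernTwo i‖, by positivity, fun n => ?_⟩
  by_cases hn : n ≤ N
  · have h1 : ‖bernTwo n‖ ≤ ∑ i ∈ range (N + 1), ‖bernTwo i‖ :=
      single_le_sum (f := fun i => ‖bernTwo i‖) (fun i _ => norm_nonneg _) (mem_range.mpr (by omega))
    have h2n : (1 : ℝ) ≤ 2 ^ n := one_le_pow₀ (by norm_num)
    calc ‖bernTwo n‖ ≤ (4 + ∑ i ∈ range (N + 1), ‖bernTwo i‖) * 1 := by linarith
      _ ≤ (4 + ∑ i ∈ range (N + 1), ‖bernTwo i‖) * 2 ^ n := mul_le_mul_of_nonneg_left h2n (by positivity)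
  · have hn0 : n ≠ 0 := by omega
    have h := hN n (by omega)
    rw [norm_genocchi_term hn0] at h
    have key : ‖bernTwo n‖ = ‖bernTwo n‖ * ((1 : ℝ) / 2) ^ (n + 2) * 2 ^ (n + 2) := by
      rw [mul_assoc, ← mul_pow]; norm_num
    calc ‖bernTwo n‖ = ‖bernTwo n‖ * ((1 : ℝ) / 2) ^ (n + 2) * 2 ^ (n + 2) := key
      _ ≤ 1 * 2 ^ (n + 2) := mul_le_mul_of_nonneg_right h.le (by positivity)
      _ = 4 * 2 ^ n := by ring
      _ ≤ (4 + ∑ i ∈ range (N + 1), ‖bernTwo i‖) * 2 ^ n := mul_le_mul_of_nonneg_right (by linarith) (by positivity)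

/-! ### The series `Σ_n B_n(−4)^n` and the re-expansion double family -/

/-- `‖−2‖₂ < 1`. -/
theorem norm_neg_two_lt_one : ‖(-2 : ℚ_[2])‖ < 1 := by
  rw [norm_neg, norm_two_padic]; norm_num

/-- `‖−4‖₂ = ¼`. -/
theorem norm_neg_four : ‖(-4 : ℚ_[2])‖ = (1 : ℝ) / 2 * (1 / 2) := by
  rw [show (-4 : ℚ_[2]) = -(2 * 2) by norm_num, norm_neg, norm_mul, norm_two_padic]

/-- The series `Σ_n B_n(−4)^n` (`= R₂(¼)/(−4)`) converges in `ℚ₂`: `‖B_n(−4)^n‖₂ ≤ C·2^{−n}`. -/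
theorem summable_bernTwo_mul_neg_four_pow : Summable fun n => bernTwo n * (-4) ^ n := by
  obtain ⟨C, hC0, hC⟩ := exists_norm_bernTwo_le
  refine Summable.of_norm_bounded (summable_geometric_two.mul_left C) fun n => ?_
  rw [norm_mul, norm_pow, norm_neg_four]
  calc ‖bernTwo n‖ * ((1 : ℝ) / 2 * (1 / 2)) ^ n ≤ C * 2 ^ n * ((1 : ℝ) / 2 * (1 / 2)) ^ n :=
        mul_le_mul_of_nonneg_right (hC n) (by positivity)
    _ = C * ((1 : ℝ) / 2) ^ n := by rw [mul_assoc, ← mul_pow]; norm_num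

/-- The double family `E(j, m) := B_j(−4)^j · binom(m+j, j)(−2)^m` on `ℕ × ℕ` — the 2-adic re-expansion of
`B_j(−4)^j/3^{j+1}` via the binomial series `1/3^{j+1} = 1/(1−(−2))^{j+1} = Σ_m binom(m+j,j)(−2)^m` (`‖−2‖₂ < 1`). -/
def reexpTerm (p : ℕ × ℕ) : ℚ_[2] := bernTwo p.1 * (-4) ^ p.1 * ((p.2 + p.1).choose p.1 : ℚ_[2]) * (-2) ^ p.2

/-- Domination `‖E(j,m)‖₂ ≤ C·2^{−j}·2^{−m}`; hence `E` is summable on `ℕ × ℕ`. -/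
theorem summable_reexpTerm : Summable reexpTerm := by
  obtain ⟨C, hC0, hC⟩ := exists_norm_bernTwo_le
  have hg : Summable fun p : ℕ × ℕ => C * ((1 : ℝ) / 2) ^ p.1 * ((1 : ℝ) / 2) ^ p.2 :=
    (summable_geometric_two.mul_left C).mul_of_nonneg summable_geometric_two (fun j => by positivity)
      fun m => by positivity
  refine Summable.of_norm_bounded hg fun p => ?_
  obtain ⟨j, m⟩ := p
  have hb := hC j
  have hc : ‖((m + j).choose j : ℚ_[2])‖ ≤ 1 := IsUltrametricDist.norm_natCast_le_one ℚ_[2] _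
  dsimp only [reexpTerm]
  rw [norm_mul, norm_mul, norm_mul, norm_pow, norm_neg_four, norm_pow, norm_neg, norm_two_padic]
  calc ‖bernTwo j‖ * ((1 : ℝ) / 2 * (1 / 2)) ^ j * ‖((m + j).choose j : ℚ_[2])‖ * ((1 : ℝ) / 2) ^ m
      ≤ C * 2 ^ j * ((1 : ℝ) / 2 * (1 / 2)) ^ j * 1 * ((1 : ℝ) / 2) ^ m := by gcongr
    _ = C * ((1 : ℝ) / 2) ^ j * ((1 : ℝ) / 2) ^ m := by rw [mul_one, mul_assoc C, ← mul_pow]; norm_num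

/-- Rows: for fixed `j`, `Σ_m E(j,m) = B_j(−4)^j · 1/(1−(−2))^{j+1} = B_j(−4)^j/3^{j+1}` (binomial series). -/
theorem hasSum_reexpTerm_row (j : ℕ) :
    HasSum (fun m => reexpTerm (j, m)) (bernTwo j * (-4) ^ j * (1 / (1 - (-2 : ℚ_[2])) ^ (j + 1))) := by
  have h := (hasSum_choose_mul_geometric_of_norm_lt_one j norm_neg_two_lt_one).mul_left (bernTwo j * (-4) ^ j)
  have e : (fun m => reexpTerm (j, m)) = fun m => bernTwo j * (-4) ^ j * (((m + j).choose j : ℚ_[2]) * (-2) ^ m) := by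
    funext m; dsimp only [reexpTerm]; ring
  rw [e]
  exact h

/-- Antidiagonals: `Σ_{j+m=n} E(j,m) = (2 − 2^n)·B_n·(−2)^n` (the coefficient identity; `(−4)^j(−2)^{n−j} = 2^j(−2)^n`). -/
theorem sum_antidiagonal_reexpTerm (n : ℕ) : ∑ p ∈ antidiagonal n, reexpTerm p = (2 - 2 ^ n) * bernTwo n * (-2) ^ n := by
  have hS := congrArg (fun q : ℚ => (q : ℚ_[2])) (sum_choose_mul_two_pow_mul_bernoulli n)
  push_cast at hS
  rw [Nat.sum_antidiagonal_eq_sum_range_succ_mk, bernTwo, ← hS, sum_mul]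
  refine sum_congr rfl fun k hk => ?_
  have hkn : k ≤ n := Nat.lt_succ_iff.mp (mem_range.mp hk)
  dsimp only [reexpTerm]
  rw [Nat.sub_add_cancel hkn, bernTwo]
  have h2 : (-2 : ℚ_[2]) ^ n = (-2) ^ k * (-2) ^ (n - k) := by rw [← pow_add, Nat.add_sub_cancel' hkn]
  rw [h2, show (-4 : ℚ_[2]) = 2 * -2 by norm_num, mul_pow]
  ring

/-- **Fubini, antidiagonals:** `Σ_n (2 − 2^n)B_n(−2)^n` converges to the sum of the double family `E`. -/
theorem hasSum_antidiagonals : HasSum (fun n => (2 - 2 ^ n) * bernTwo n * (-2) ^ n) (∑' p, reexpTerm p) := by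
  have h1 : HasSum (fun n => ∑ p ∈ antidiagonal n, reexpTerm p) (∑' p, reexpTerm p) :=
    (HasAntidiagonal.sigmaAntidiagonalEquivProd.hasSum_iff.mpr summable_reexpTerm.hasSum).sigma
      fun n => (antidiagonal n).hasSum reexpTerm
  simpa only [sum_antidiagonal_reexpTerm] using h1

/-- **Fubini, rows:** `Σ_j B_j(−4)^j/3^{j+1}` converges to the same sum. -/
theorem hasSum_rows :
    HasSum (fun j => bernTwo j * (-4) ^ j * (1 / (1 - (-2 : ℚ_[2])) ^ (j + 1))) (∑' p, reexpTerm p) :=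
  summable_reexpTerm.hasSum.prod_fiberwise hasSum_reexpTerm_row

/-! ### `ζ₂(2)` by the explicit Kubota–Leopoldt series ([Wa97, Thm. 5.11]; [Be08, Appendix]) -/

/-- Beukers' Teichmüller character at `p = 2` on odd `a`: `ω(a) = (−1)^{(a−1)/2}` ([Be08, Appendix]); `ω(1) = 1`, `ω(3) = −1`. -/
def teichTwo (a : ℕ) : ℤ := (-1) ^ ((a - 1) / 2)

/-- `ω(1) = 1`. -/
theorem teichTwo_one : teichTwo 1 = 1 := by norm_num [teichTwo]

/-- `ω(3) = −1`. -/
theorem teichTwo_three : teichTwo 3 = -1 := by norm_num [teichTwo]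

/-- **The 2-adic Hurwitz series at `s = 2`** ([Be08, Appendix] `H_p(s,a,F)` at `p = 2`, `s = 2`; the summand of
[Wa97, Thm. 5.11]): `H₂(2; a, F) := (1/F)·⟨a⟩⁻¹·Σ'_{j≥0} binom(1−s, j)|_{s=2}·B_j·(F/a)^j = (1/F)·(ω(a)/a)·Σ'_j (−1)^j·B_j·(F/a)^j`
(`⟨a⟩ = ω(a)⁻¹a`, `binom(−1,j) = (−1)^j`; intended for `4 ∣ F`, `a` odd, where the series converges 2-adically). -/
def hurwitzTwoAtTwo (a F : ℕ) : ℚ_[2] :=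
  (F : ℚ_[2])⁻¹ * ((teichTwo a : ℚ_[2]) / a) * ∑' j : ℕ, (-1) ^ j * bernTwo j * ((F : ℚ_[2]) / a) ^ j

/-- **`ζ₂(2)`, explicitly:** `ζ₂(2) := L₂(2, 𝟙) = H₂(2;1,4) + H₂(2;3,4)` ([Be08, Appendix, last formula];
[Wa97, Thm. 5.11] with `χ = 1`, `p = 2`, `F = q = 4`).  Definition-relative: that this number is the value at `2` of the
analytic Kubota–Leopoldt zeta function is [Wa97, Thm. 5.11], printed, not formalised. -/
def zetaTwoAtTwo : ℚ_[2] := hurwitzTwoAtTwo 1 4 + hurwitzTwoAtTwo 3 4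

/-- `H₂(2;1,4) = ¼·Σ'_n B_n(−4)^n`. -/
theorem hurwitzTwoAtTwo_one_four : hurwitzTwoAtTwo 1 4 = 4⁻¹ * ∑' n, bernTwo n * (-4) ^ n := by
  have e : ∀ j : ℕ, (-1 : ℚ_[2]) ^ j * bernTwo j * (4 : ℚ_[2]) ^ j = bernTwo j * (-4) ^ j := fun j => by
    rw [show (-4 : ℚ_[2]) = -1 * 4 by norm_num, mul_pow]; ring
  simp only [hurwitzTwoAtTwo, teichTwo_one, Nat.cast_ofNat, Nat.cast_one, Int.cast_one, div_one, mul_one, e]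

/-- `H₂(2;3,4) = −¼·Σ'_n (2 − 2^n)B_n(−2)^n`: `Σ'_j (−1)^jB_j(4/3)^j = 3·Σ'_j B_j(−4)^j/3^{j+1} = 3·Σ'_n (2−2^n)B_n(−2)^n`
by the two Fubini evaluations of `E`. -/
theorem hurwitzTwoAtTwo_three_four :
    hurwitzTwoAtTwo 3 4 = -(4⁻¹ * ∑' n, (2 - 2 ^ n) * bernTwo n * (-2) ^ n) := by
  have h3 : HasSum (fun j => (-1 : ℚ_[2]) ^ j * bernTwo j * ((4 : ℚ_[2]) / 3) ^ j) (3 * ∑' p, reexpTerm p) := by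
    have e : (fun j => (-1 : ℚ_[2]) ^ j * bernTwo j * ((4 : ℚ_[2]) / 3) ^ j) =
        fun j => 3 * (bernTwo j * (-4) ^ j * (1 / (1 - (-2 : ℚ_[2])) ^ (j + 1))) := by
      funext j
      rw [show (1 : ℚ_[2]) - -2 = 3 by norm_num, div_pow, show (-4 : ℚ_[2]) = -1 * 4 by norm_num, mul_pow, pow_succ]
      field_simp
    rw [e]
    exact hasSum_rows.mul_left 3
  simp only [hurwitzTwoAtTwo, teichTwo_three, Nat.cast_ofNat, Int.cast_neg, Int.cast_one, h3.tsum_eq,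
    hasSum_antidiagonals.tsum_eq]
  ring

/-- **`ζ₂(2) = ¼·Σ'_n (2^{n+1} − 2)·B_n·(−2)^n = ⅛·Σ'_k G_k(−2)^{k+1}`** — the Genocchi form of K5b's right-hand side. -/
theorem hasSum_genocchi_zetaTwoAtTwo :
    HasSum (fun k => ((genocchi k * (-2) ^ (k + 1) : ℚ) : ℚ_[2])) (8 * zetaTwoAtTwo) := by
  have hU := summable_bernTwo_mul_neg_four_pow.hasSum
  have hW := hasSum_antidiagonals
  have e : (fun k => ((genocchi k * (-2) ^ (k + 1) : ℚ) : ℚ_[2])) =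
      fun n => 2 * (bernTwo n * (-4) ^ n - (2 - 2 ^ n) * bernTwo n * (-2) ^ n) := by
    funext k
    rw [genocchi, bernTwo]
    push_cast
    rw [show (-4 : ℚ_[2]) = 2 * -2 by norm_num, mul_pow]
    ring
  have h8 : 8 * zetaTwoAtTwo = 2 * ((∑' n, bernTwo n * (-4) ^ n) - ∑' p, reexpTerm p) := by
    rw [zetaTwoAtTwo, hurwitzTwoAtTwo_one_four, hurwitzTwoAtTwo_three_four, hW.tsum_eq]
    ring
  rw [e, h8]
  exact (hU.sub hW).mul_left 2

/-- **Kernel K5d — `ξ = ζ₂(2)` in `ℚ₂`:** the lane's 2-adic constant `ξ = ⅛Σ'_μ t_μ/(μ+½)` (`CatalanTwoAdicXi.xi`) equals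
the explicitly defined Kubota–Leopoldt value `zetaTwoAtTwo` (K5b's `hasSum_genocchi` and `hasSum_genocchi_zetaTwoAtTwo`
sum the same series).  With this, (C6) of the paper is kernel-checked up to the printed identification of the explicit
series with the analytic `ζ₂` ([Wa97, Thm. 5.11]). -/
theorem xi_eq_zetaTwoAtTwo : xi = zetaTwoAtTwo := by
  have h := hasSum_genocchi.unique hasSum_genocchi_zetaTwoAtTwo
  have h8 : (8 : ℚ_[2]) ≠ 0 := by norm_num
  exact mul_left_cancel₀ h8 h

/-- **`8·ζ₂(2) = −Θ₂(½)`** ([Be08, Prop. 9], Bernoulli form): `8·ζ₂(2) = −Σ'_k (2^{k+1}−2)·B_k·(−2)^{k+1}`. -/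
theorem eight_mul_zetaTwoAtTwo_eq_neg_theta :
    8 * zetaTwoAtTwo = -(∑' k : ℕ, ((((2 : ℚ) ^ (k + 1) - 2) * bernoulli k * (-2) ^ (k + 1) : ℚ) : ℚ_[2])) := by
  rw [← xi_eq_zetaTwoAtTwo]
  exact CatalanTwoAdicTheta.eight_mul_xi_eq_neg_tsum_bernoulli

/-- **Irrationality of the explicitly defined `ζ₂(2)`** (kernel-checked, for THIS number): `ζ₂(2) ≠ r` for every
`r ∈ ℚ`, from the lane's `xi_not_ratCast` (`CatalanTwoAdicFinal`, the certified 2-adic Catalan-ray argument) and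
`ξ = ζ₂(2)`.  In print (for the analytic `ζ₂(2)`): Calegari (2005), [Be08, Cor. 14]. -/
theorem zetaTwoAtTwo_not_ratCast (r : ℚ) : zetaTwoAtTwo ≠ ((r : ℚ) : ℚ_[2]) := by
  rw [← xi_eq_zetaTwoAtTwo]
  exact xi_not_ratCast r

/-! ### Beukers' `R`-forms ([Be08, §§1, 5, Appendix]) -/

/-- Beukers' `R(x) = Σ_n B_n(−1/x)^{n+1}` evaluated 2-adically, as a function of `c = −1/x`:
`bernR c := Σ'_n B_n c^{n+1}`; so `R₂(a/F) = bernR (−F/a)`. -/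
def bernR (c : ℚ_[2]) : ℚ_[2] := ∑' n, bernTwo n * c ^ (n + 1)

/-- `R₂(¼) = bernR(−4) = −4·Σ'_n B_n(−4)^n`. -/
theorem bernR_neg_four : bernR (-4) = -4 * ∑' n, bernTwo n * (-4) ^ n := by
  rw [bernR, ← tsum_mul_left]
  exact tsum_congr fun n => by ring

/-- `R₂(¾) = bernR(−4/3) = −4·Σ'_n (2−2^n)B_n(−2)^n` (re-expansion). -/
theorem bernR_neg_four_thirds : bernR (-4 / 3) = -4 * ∑' n, (2 - 2 ^ n) * bernTwo n * (-2) ^ n := by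
  have h : HasSum (fun n => bernTwo n * (-4 / 3 : ℚ_[2]) ^ (n + 1)) (-4 * ∑' p, reexpTerm p) := by
    have e : (fun n => bernTwo n * (-4 / 3 : ℚ_[2]) ^ (n + 1)) =
        fun j => -4 * (bernTwo j * (-4) ^ j * (1 / (1 - (-2 : ℚ_[2])) ^ (j + 1))) := by
      funext j
      rw [show (1 : ℚ_[2]) - -2 = 3 by norm_num, div_pow, pow_succ]
      field_simp
    rw [e]
    exact hasSum_rows.mul_left (-4)
  rw [bernR, h.tsum_eq, hasSum_antidiagonals.tsum_eq]

/-- **[Be08, §5 / Appendix] for `ζ₂(2)`:** `ζ₂(2) = H₂(2;1,4) + H₂(2;3,4) = (R₂(¾) − R₂(¼))/16`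
(`H₂(2;a,F) = −(ω(a)/F²)·R₂(a/F)`). -/
theorem zetaTwoAtTwo_eq_bernR : zetaTwoAtTwo = 16⁻¹ * (bernR (-4 / 3) - bernR (-4)) := by
  rw [zetaTwoAtTwo, hurwitzTwoAtTwo_one_four, hurwitzTwoAtTwo_three_four, bernR_neg_four_thirds, bernR_neg_four]
  ring

/-- **[Be08, p. 8]:** `Θ₂(½) = (R₂(¼) − R₂(¾))/2` (`= −8ζ₂(2)`), with `Θ₂(½) = Σ'_k (2^{k+1}−2)B_k(−2)^{k+1}`. -/
theorem theta_half_eq_bernR :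
    ∑' k : ℕ, ((((2 : ℚ) ^ (k + 1) - 2) * bernoulli k * (-2) ^ (k + 1) : ℚ) : ℚ_[2]) = (bernR (-4) - bernR (-4 / 3)) / 2 := by
  have h := eight_mul_zetaTwoAtTwo_eq_neg_theta
  rw [zetaTwoAtTwo_eq_bernR] at h
  linear_combination h

end Summit.KontsevichZagierPeriods.Zeta5Search.CatalanTwoAdicZeta

end
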